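import Summits.AtomisticToContinuum.FouriersLaw.Theorems.BondHeatUncertaintyExtensiveSnapshotIrreversibilityEnergyWindowDilationDepartureA
import Summits.AtomisticToContinuum.FouriersLaw.Theorems.BondHeatUncertaintyExtensiveSnapshotIrreversibilityEnergyWindowScoreOrderOne
import Summits.AtomisticToContinuum.FouriersLaw.Theorems.BondHeatUncertaintyExtensiveSnapshotIrreversibilityEnergyWindowCostateObservability

/-!
# Bond heat uncertainty — node «DilationDeparture» (part X-1): the DEPARTURE side of the
  dilation Duhamel — (EBᵈ) and (XBⁿ) from the ORDER-1 departure score duals of index `0`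
  in the momentum direction `e_{p_b}` ((SD₁), tree) and the position direction `e_{q_b}` ((SD₁q),
  typed here)

Cell `decomp-a2c`, lens «grading / quantitative ladder», generation 87 (critic row 1231 (4):
«g87 = X-3 ScoreOrderOneQ → X-1 DilationDeparture → X-2 DilationArrival»; this part is X-1).
Record beneath S3 after part W (`…EnergyWindowDilationDuhamel`, rows 1218/1231):
`S3ˢ ⟸ (Dᵛ) ∧ (EBᵃ) ∧ (EBᵈ) ∧ (XBⁿ) ∧ (XBᶠ)` (`kernelTemperatureLipschitz_of_dilation`).

## What is proved in this node (no proof holes; two files)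

Part X-1A (`…EnergyWindowDilationDepartureA`, imported):
* A§1 **(SD₁q)** `DensityScoreDualBoundPosition[On I]` — the POSITION twin of the tree's graded
  score dual bound `DensityScoreDualBoundOn` (part U): the text of `densityScoreDualBodyOn` with
  the bath-momentum derivatives `densityDeriv` replaced by the bath-POSITION derivatives
  `densityDerivQ` (`0 ↦ ∂_{x_{q_b}} p(s,·,y)(z)` departure, `1 ↦ ∂_{y_{q_b}} p(s,z,·)(y)` arrival).
  Skeleton side (X-3, not here): the `q_b`-rows of `(Γ_m + κ)⁻¹`, covered by (MC∞).
* A§2 density toolbox in an ARBITRARY departure direction `v`: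
  `hasLineDerivAt_integral_mul_density` (`x ↦ ∫ G(y) p(s,x,y) dy` has line derivative
  `∫ G(y) D_x p(s,·,y)(x)·v dy` for `G ∈ C¹_c` — dominated differentiation, the tree's
  `hasDerivAt_integral_mul_density` being the case `v = (0,e_b)`), hence
  `partialP_integral_mul_density` / `partialQ_integral_mul_density` (`∂_{p_b}`, `∂_{q_b}` of
  `x ↦ ∫ G p(s,x,·)` are the index-`0` duals' integrands — NO regularity of `P_s G` is needed, the
  coordinate derivatives of `FouriersLaw.lean` being line derivatives for every function),
  their CONTINUITY in `x` (`continuous_parametric_integral_of_continuous` on `tsupport G`),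
  `pertKernelFun_eq_integral_mul_density` (`P^δ_t h (w) = ∫ h(y) p(t,w,y) dy`), the CEHR (3.4)
  root bound `rpow_integral_abs_rpow_mul_density_le`
  (`(∫ |G|^r p(t,w,·))^{1/r} ≤ e^{θγ(T_L+T_R)} e^{θH(w)}` for `|G| ≤ e^{θH}`, `rθ < 1/max T`), and
  the coefficient bound `exists_bathCoeff_le_exp` (A§3; `|p_b|, |∂_{q_b}H| ≤ K_η e^{ηH}`, from the
  Literature's `abs_dPotential_le` for the confining pinned chain), `twoTemperature_window`.

This file:
* §1 ★ `dilationDepartureBound_of_scoreDual : DensityScoreDualBoundOn {0} → (EBᵈ)` and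
  ★ `exchangeTermBoundNear_of_scoreDuals :
      DensityScoreDualBoundOn {0} → DensityScoreDualBoundPositionOn {0} → (XBⁿ)`.
  Route ((EBᵈ)): `D_b(P^δ_1 h)(z) = z_{p_b} ∫ h(y) ∂_{x_{p_b}}p(1,·,y)(z) dy`; the index-`0` dual at
  `s = 1` with the test function `G = h` ITSELF (smooth, compactly supported — no regularisation),
  exponents `r = θ'/θ`, `ε = η = (θ'−θ)/2`: `|∫ h D₀| ≤ (∫|h|^r p)^{1/r} C e^{εH(z)} ≤
  e^{2γTθ} e^{θH(z)} C e^{εH(z)}` (CEHR (3.4), `rθ = θ' < 1/max(T ± δ/2)` for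
  `|δ| < δ₀ ≤ 1/θ' − T`), `|z_{p_b}| ≤ K_η e^{ηH(z)}`; total rate `θ + ε + η = θ'`.
  Route ((XBⁿ)): for `s ∈ (0, ½]`, `u = P^δ_{1−s} h`, `1 − s ∈ [½, 1)`:
  `∂_{p_b}u(w) = ∫ h ∂_{x_{p_b}}p(1−s,·,y)(w) dy`, `∂_{q_b}u(w) = ∫ h ∂_{x_{q_b}}p(1−s,·,y)(w) dy`
  (A§2), bounded by the two index-`0` duals and CEHR as above:
  `|𝒜_b u(w)| ≤ K_η e^{2γTθ}(C_q + C_p) e^{θ'H(w)}`; `𝒜_b u` is CONTINUOUS (A§2), so CEHR (3.4) at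
  time `s` from `z` gives `|P^δ_s(𝒜_b u)(z)| ≤ M e^{θ'γ·2T·s} e^{θ'H(z)} ≤ M e^{2γTθ'} e^{θ'H(z)}`.
  NEITHER proof uses the two-temperature orbit smoothness (R2^δ) of the g86 plan (the stub
  `stub_departure_side (h0) (hq) (hR)` of g86/scratch/SignatureX.lean is discharged WITHOUT `hR`).
* §2 junctions: ★★ `kernelTemperatureLipschitz_of_dilation_departure :
  (Dᵛ) → (EBᵃ) → DensityScoreDualBoundOn {0} → DensityScoreDualBoundPositionOn {0} → (XBᶠ) → S3`,
  the same from (SD₁) `DensityScoreDualBoundFirst` and the full (SD₁q)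
  (`kernelTemperatureLipschitz_of_dilation_first`), ★★ the RECORD JUNCTION
  `kernelTemperatureLipschitz_of_dilation_gram :
  (Dᵛ) → (EBᵃ) → (RW₁) GramControlledWeightMoments → DensityScoreDualBoundPositionOn {0} → (XBᶠ)
  → S3` (the momentum departure dual supplied by the tree's (SD₁) ⟸ (MC∞) ∧ (RW₁),
  `densityScoreDualBoundFirst_of_gram`, with (MC∞) PROVED,
  `skeletonGramLimitInverseMoments_proved`), and the K_fix junctions `snapshotKLUpperExpansion_of_atoms₉X` / `…₉G`.

Hence the record beneath S3 after this part (`kernelTemperatureLipschitz_of_dilation_gram`):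
`S3 ⟸ (Dᵛ)[INSTR·hands] ∧ (EBᵃ)[X-2] ∧ (RW₁)[prover seat] ∧ (SD₁q)On{0}[X-3] ∧ (XBᶠ)[X-2]`
((MC∞) discharged by name).
Only `def`/`theorem` declarations; no proof holes.  References: N. Cuneo, J.-P. Eckmann,
M. Hairer, L. Rey-Bellet, Electron. J. Probab. 23 (2018) no. 55, Prop. 3.2, §3 eq. (3.2)–(3.4);
D. Nualart, *The Malliavin Calculus and Related Topics* (2006), Prop. 2.1.4; J.-M. Bismut,
*Large deviations and the Malliavin calculus* (1984); K. D. Elworthy, X.-M. Li, J. Funct. Anal.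
125 (1994), Thm 2.1.
-/

noncomputable section

namespace Summit.AtomisticToContinuum.FouriersLaw.Theorems.ExtensiveSnapshotIrreversibility.EnergyWindow

open MeasureTheory Filter Topology Real Set Metric
open scoped ENNReal NNReal ContDiff
open Literature.MathematicalPhysics.KineticTheory.HeatConduction Literature.Probability.Process

variable {N : ℕ}

/-! ## 1. ★ The departure side: (EBᵈ) and (XBⁿ) from the index-`0` departure duals -/

/-- ★ **(SD₁) index `0` ⟹ (EBᵈ)**: the departure dilation bound from the ORDER-1 departure score
dual in the momentum direction.  `D_b(P^δ_1 h)(z) = z_{p_b} ∫ h(y) ∂_{x_{p_b}}p(1,·,y)(z) dy`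
(`partialP_integral_mul_density`); the dual at `s = 1` with the test function `G = h` itself,
`r = θ'/θ`, `ε = (θ'−θ)/2`; CEHR (3.4) turns `(∫|h|^r p(1,z,·))^{1/r}` into `e^{2γTθ} e^{θH(z)}`
(`rθ = θ' < 1/max(T ± δ/2)` for `|δ| < 1/θ' − T`); `|z_{p_b}| ≤ K e^{εH(z)}`; rates
`θ + ε + ε = θ'`.  No second-order quantity, no regularity of `P^δ_1 h`.
[cite: CuneoEckmannHairerReyBellet2018, §3 eq. (3.4)] -/
theorem dilationDepartureBound_of_scoreDual (hSD : DensityScoreDualBoundOn {0}) :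
    DilationDepartureBound := by
  intro ω₂ lam β γ hω hl hβ hγ T hT N hN θ θ' hθ hθθ' hθ'1
  have hθ'0 : 0 < θ' := hθ.trans hθθ'
  have hgap : 0 < θ' - θ := sub_pos.2 hθθ'
  set ε : ℝ := (θ' - θ) / 2 with hε
  have hε0 : 0 < ε := by positivity
  set r : ℝ := θ' / θ with hr
  have hr1 : 1 < r := (one_lt_div hθ).2 hθθ'
  have hrθ : r * θ = θ' := by rw [hr]; field_simp
  obtain ⟨δ₁, C₁, hδ₁, hC₁, hW⟩ := hSD ω₂ lam β γ hω hl hβ hγ T hT N hN r ε hr1 hε0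
  obtain ⟨K, hK0, hK⟩ := exists_bathCoeff_le_exp hω hl.le hβ.le hγ.le N hε0
  have hTθ : θ' * T < 1 := by rwa [lt_div_iff₀ hT] at hθ'1
  have hg : 0 < 1 / θ' - T := by rw [sub_pos, lt_div_iff₀ hθ'0]; linarith
  set H := (pinnedChain ω₂ lam β γ).hamiltonian N with hH
  set E : ℝ := Real.exp (θ * γ * (T + T)) with hEdef
  refine ⟨min δ₁ (min T (1 / θ' - T)), K * (E * C₁), lt_min hδ₁ (lt_min hT hg),
    fun δ hδ h hhC hhc hhθ b hb z => ?_⟩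
  have hδ₁' : |δ| < δ₁ := lt_of_lt_of_le hδ (min_le_left _ _)
  obtain ⟨hL, hR, hθmax⟩ :=
    twoTemperature_window hT hθ'0 hθ'1 (lt_of_lt_of_le hδ (min_le_right _ _))
  have hN0 : 0 < N := by omega
  obtain ⟨p, hp⟩ := isTransitionDensity_exists hω hl.le hβ.le hγ hN0 hL hR.le
  -- the departure derivative is the index-0 dual's integrand
  have hD : partialP b (pertKernelFun ω₂ lam β γ T δ N h 1) z =
      ∫ y, h y * densityDeriv p 1 b z 0 y := by
    rw [pertKernelFun_eq_integral_mul_density hp one_pos h]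
    exact partialP_integral_mul_density hp one_pos b z (hhC.of_le (by exact_mod_cast le_top)) hhc
  have hdual := hW δ hδ₁' p hp 1 (by norm_num) le_rfl b hb z h hhC hhc 0 (Set.mem_singleton _)
  have hroot := rpow_integral_abs_rpow_mul_density_le hω hl hβ hγ hN0 hL hR hθ hr1 (by rwa [hrθ])
    hp one_pos le_rfl z hhθ
  have h2T : T + δ / 2 + (T - δ / 2) = T + T := by ring
  rw [h2T] at hroot
  have hI : |∫ y, h y * densityDeriv p 1 b z 0 y| ≤
      (E * Real.exp (θ * H z)) * (C₁ * Real.exp (ε * H z)) :=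
    hdual.trans (mul_le_mul_of_nonneg_right hroot (by positivity))
  simp only [dilationDeparture, momDilation]
  rw [hD, abs_mul]
  calc |z.2 b| * |∫ y, h y * densityDeriv p 1 b z 0 y|
      ≤ (K * Real.exp (ε * H z)) * ((E * Real.exp (θ * H z)) * (C₁ * Real.exp (ε * H z))) :=
        mul_le_mul (hK b z).1 hI (abs_nonneg _) (by positivity)
    _ = K * (E * C₁) * Real.exp (θ' * H z) := by
        have e3 : θ' * H z = ε * H z + (θ * H z + ε * H z) := by rw [hε]; ring
        rw [e3, Real.exp_add, Real.exp_add]; ring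

/-- ★ **(SD₁) index `0` ∧ (SD₁q) index `0` ⟹ (XBⁿ)**: the near-half exchange bound from the
ORDER-1 departure score duals in the directions `e_{p_b}` and `e_{q_b}`.  For `s ∈ (0, ½]` and
`u = P^δ_{1−s} h` (`1 − s ∈ [½, 1)`): `∂_{p_b}u(w) = ∫ h ∂_{x_{p_b}}p(1−s,·,y)(w) dy`,
`∂_{q_b}u(w) = ∫ h ∂_{x_{q_b}}p(1−s,·,y)(w) dy` (part A §2, no regularity of `u` needed), each
`≤ e^{2γTθ} e^{θH(w)} C e^{εH(w)}` by the duals (test function `h`, `r = θ'/θ`) and CEHR (3.4);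
with `|p_b|, |∂_{q_b}H| ≤ K e^{εH}`: `|𝒜_b u| ≤ M e^{θ'H}`, `𝒜_b u` continuous (A §2); CEHR (3.4)
at time `s` from `z`: `|P^δ_s 𝒜_b u (z)| ≤ M e^{2γTθ' s} e^{θ'H(z)} ≤ M e^{2γTθ'} e^{θ'H(z)}`.
[cite: CuneoEckmannHairerReyBellet2018, §3 eq. (3.2)–(3.4)] -/
theorem exchangeTermBoundNear_of_scoreDuals (hP : DensityScoreDualBoundOn {0})
    (hQ : DensityScoreDualBoundPositionOn {0}) : ExchangeTermBoundNear := by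
  intro ω₂ lam β γ hω hl hβ hγ T hT N hN θ θ' hθ hθθ' hθ'1
  have hθ'0 : 0 < θ' := hθ.trans hθθ'
  have hgap : 0 < θ' - θ := sub_pos.2 hθθ'
  set ε : ℝ := (θ' - θ) / 2 with hε
  have hε0 : 0 < ε := by positivity
  set r : ℝ := θ' / θ with hr
  have hr1 : 1 < r := (one_lt_div hθ).2 hθθ'
  have hrθ : r * θ = θ' := by rw [hr]; field_simp
  obtain ⟨δ₁, C₁, hδ₁, hC₁, hW₁⟩ := hP ω₂ lam β γ hω hl hβ hγ T hT N hN r ε hr1 hε0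
  obtain ⟨δ₂, C₂, hδ₂, hC₂, hW₂⟩ := hQ ω₂ lam β γ hω hl hβ hγ T hT N hN r ε hr1 hε0
  obtain ⟨K, hK0, hK⟩ := exists_bathCoeff_le_exp hω hl.le hβ.le hγ.le N hε0
  have hTθ : θ' * T < 1 := by rwa [lt_div_iff₀ hT] at hθ'1
  have hg : 0 < 1 / θ' - T := by rw [sub_pos, lt_div_iff₀ hθ'0]; linarith
  set P := pinnedChain ω₂ lam β γ with hPdef
  set H := P.hamiltonian N with hH
  set E : ℝ := Real.exp (θ * γ * (T + T)) with hEdef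
  set M : ℝ := K * (E * (C₂ + C₁)) with hM
  have hM0 : 0 ≤ M := by positivity
  refine ⟨min (min δ₁ δ₂) (min T (1 / θ' - T)), M * Real.exp (θ' * γ * (T + T)),
    lt_min (lt_min hδ₁ hδ₂) (lt_min hT hg), fun δ hδ h hhC hhc hhθ b hb z s hs0 hs12 => ?_⟩
  have hδ₁' : |δ| < δ₁ := lt_of_lt_of_le hδ ((min_le_left _ _).trans (min_le_left _ _))
  have hδ₂' : |δ| < δ₂ := lt_of_lt_of_le hδ ((min_le_left _ _).trans (min_le_right _ _))
  obtain ⟨hL, hR, hθmax⟩ :=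
    twoTemperature_window hT hθ'0 hθ'1 (lt_of_lt_of_le hδ (min_le_right _ _))
  have hN0 : 0 < N := by omega
  obtain ⟨p, hp⟩ := isTransitionDensity_exists hω hl.le hβ.le hγ hN0 hL hR.le
  have ht0 : 0 < 1 - s := by linarith
  have ht12 : 1 / 2 ≤ 1 - s := by linarith
  have ht1 : 1 - s ≤ 1 := by linarith
  have hs1 : s ≤ 1 := by linarith
  have hh1 : ContDiff ℝ 1 h := hhC.of_le (by exact_mod_cast le_top)
  have h2T : T + δ / 2 + (T - δ / 2) = T + T := by ring
  -- `u = P^δ_{1-s} h` as a density integral, its two bath derivatives and their bounds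
  have hu := pertKernelFun_eq_integral_mul_density hp ht0 h
  have hroot : ∀ w : PhaseSpace N, (∫ y, |h y| ^ r * p (1 - s) w y) ^ (1 / r) ≤
      E * Real.exp (θ * H w) := fun w => by
    have h0 := rpow_integral_abs_rpow_mul_density_le hω hl hβ hγ hN0 hL hR hθ hr1 (by rwa [hrθ])
      hp ht0 ht1 w hhθ
    rwa [h2T] at h0
  have hbp : ∀ w : PhaseSpace N, |partialP b (pertKernelFun ω₂ lam β γ T δ N h (1 - s)) w| ≤
      (E * Real.exp (θ * H w)) * (C₁ * Real.exp (ε * H w)) := fun w => by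
    rw [hu, partialP_integral_mul_density hp ht0 b w hh1 hhc]
    exact (hW₁ δ hδ₁' p hp (1 - s) ht12 ht1 b hb w h hhC hhc 0 (Set.mem_singleton _)).trans
      (mul_le_mul_of_nonneg_right (hroot w) (by positivity))
  have hbq : ∀ w : PhaseSpace N, |partialQ b (pertKernelFun ω₂ lam β γ T δ N h (1 - s)) w| ≤
      (E * Real.exp (θ * H w)) * (C₂ * Real.exp (ε * H w)) := fun w => by
    rw [hu, partialQ_integral_mul_density hp ht0 b w hh1 hhc]
    exact (hW₂ δ hδ₂' p hp (1 - s) ht12 ht1 b hb w h hhC hhc 0 (Set.mem_singleton _)).trans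
      (mul_le_mul_of_nonneg_right (hroot w) (by positivity))
  -- the integrand `𝒜_b u`: continuity and the pointwise bound
  set φ := bathExchange P N b (pertKernelFun ω₂ lam β γ T δ N h (1 - s)) with hφ
  have hHq : Continuous (partialQ b H) := by
    have hHd : ContDiff ℝ 1 H := pinnedChain_contDiff_hamiltonian ω₂ lam β γ N
    rw [partialQ_eq_fderiv (hHd.differentiable one_ne_zero) b]
    exact (hHd.continuous_fderiv one_ne_zero).clm_apply continuous_const
  have hφc : Continuous φ := by
    have e : φ = fun w => w.2 b * partialQ b (fun x => ∫ y, h y * p (1 - s) x y) w +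
        partialQ b H w * partialP b (fun x => ∫ y, h y * p (1 - s) x y) w := by
      rw [hφ, hu]; rfl
    rw [e]
    exact (((continuous_apply b).comp continuous_snd).mul
      (continuous_partialQ_integral_mul_density hp ht0 b hh1 hhc)).add
      (hHq.mul (continuous_partialP_integral_mul_density hp ht0 b hh1 hhc))
  have hφb : ∀ w, |φ w| ≤ M * Real.exp (θ' * H w) := by
    intro w
    have e3 : θ' * H w = ε * H w + (θ * H w + ε * H w) := by rw [hε]; ring
    have hsum : |φ w| ≤ |w.2 b| * |partialQ b (pertKernelFun ω₂ lam β γ T δ N h (1 - s)) w| +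
        |partialQ b H w| * |partialP b (pertKernelFun ω₂ lam β γ T δ N h (1 - s)) w| := by
      rw [hφ]; dsimp only [bathExchange]
      rw [← abs_mul, ← abs_mul]; exact abs_add_le _ _
    calc |φ w| ≤ (K * Real.exp (ε * H w)) * ((E * Real.exp (θ * H w)) * (C₂ * Real.exp (ε * H w))) +
          (K * Real.exp (ε * H w)) * ((E * Real.exp (θ * H w)) * (C₁ * Real.exp (ε * H w))) :=
          hsum.trans (add_le_add (mul_le_mul (hK b w).1 (hbq w) (abs_nonneg _) (by positivity))
            (mul_le_mul (hK b w).2 (hbp w) (abs_nonneg _) (by positivity)))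
      _ = M * Real.exp (θ' * H w) := by
          rw [hM, e3, Real.exp_add, Real.exp_add]; ring
  -- CEHR (3.4) at time `s` from `z`
  obtain ⟨-, hout⟩ := integrable_and_abs_integral_transitionKernel_le hω hl hβ hγ hN0 hL hR hθ'0
    hθmax s.toNNReal z hM0 hφc.measurable hφb
  simp only [Real.coe_toNNReal _ hs0.le, h2T] at hout
  have hexp : Real.exp (θ' * γ * (T + T) * s) ≤ Real.exp (θ' * γ * (T + T)) :=
    Real.exp_le_exp.2 (mul_le_of_le_one_right (by positivity) hs1)
  simp only [exchangeIntegrand, pertKernel]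
  calc _ ≤ M * (Real.exp (θ' * γ * (T + T) * s) * Real.exp (θ' * H z)) := hout
    _ ≤ M * (Real.exp (θ' * γ * (T + T)) * Real.exp (θ' * H z)) :=
        mul_le_mul_of_nonneg_left (mul_le_mul_of_nonneg_right hexp (Real.exp_pos _).le) hM0
    _ = M * Real.exp (θ' * γ * (T + T)) * Real.exp (θ' * H z) := by ring

/-! ## 2. Junctions: S3 and K_fix with the departure side discharged -/

/-- ★★ **`(Dᵛ) → (EBᵃ) → (SD₁){0} → (SD₁q){0} → (XBᶠ) → S3`** (`KernelTemperatureLipschitz`):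
the departure dilation bound and the near-half exchange bound of the record
`kernelTemperatureLipschitz_of_dilation` are DISCHARGED by the two index-`0` departure duals.
[folklore] -/
theorem kernelTemperatureLipschitz_of_dilation_departure (hV : KernelTemperatureDilationDuhamel)
    (hA : DilationArrivalBound) (h0 : DensityScoreDualBoundOn {0})
    (hq : DensityScoreDualBoundPositionOn {0}) (hF : ExchangeTermBoundFar) :
    KernelTemperatureLipschitz :=
  kernelTemperatureLipschitz_of_dilation hV hA (dilationDepartureBound_of_scoreDual h0)
    (exchangeTermBoundNear_of_scoreDuals h0 hq) hF

/-- ★★ The same from the tree's (SD₁) `DensityScoreDualBoundFirst` (itself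
`⟸ (MC∞) ∧ (RW₁)`, `densityScoreDualBoundFirst_of_gram`, with (MC∞) PROVED,
`skeletonGramLimitInverseMoments_proved`) and the full (SD₁q). [folklore] -/
theorem kernelTemperatureLipschitz_of_dilation_first (hV : KernelTemperatureDilationDuhamel)
    (hA : DilationArrivalBound) (h1 : DensityScoreDualBoundFirst)
    (hq : DensityScoreDualBoundPosition) (hF : ExchangeTermBoundFar) :
    KernelTemperatureLipschitz :=
  kernelTemperatureLipschitz_of_dilation_departure hV hA
    (densityScoreDualBoundOn_mono (by simp) h1)
    (densityScoreDualBoundPositionOn_mono (Set.subset_univ _) hq) hF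

/-- ★★ **The junction `K_fix ⟸ A0 ∧ A2 ∧ (Dᵛ) ∧ (EBᵃ) ∧ (SD₁){0} ∧ (SD₁q){0} ∧ (XBᶠ) ∧ A3p ∧ A4`**
(`SnapshotKLUpperExpansion`, via `snapshotKLUpperExpansion_of_atoms₅K`). [folklore] -/
theorem snapshotKLUpperExpansion_of_atoms₉X (h0 : NessGibbsReweighting)
    (h2 : NessOddLogRatioBound) (hV : KernelTemperatureDilationDuhamel)
    (hA : DilationArrivalBound) (hd : DensityScoreDualBoundOn {0})
    (hq : DensityScoreDualBoundPositionOn {0}) (hF : ExchangeTermBoundFar)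
    (h3p : NessFloorMeanValue) (h4 : NessLinearResponseL2) : SnapshotKLUpperExpansion :=
  snapshotKLUpperExpansion_of_atoms₅K h0 h2
    (kernelTemperatureLipschitz_of_dilation_departure hV hA hd hq hF) h3p h4

/-- ★★ **RECORD JUNCTION after part X-1**:
`(Dᵛ) → (EBᵃ) → (RW₁) → (SD₁q){0} → (XBᶠ) → S3` — the momentum departure dual (SD₁){0} is
supplied by the tree's order-1 junction (SD₁) ⟸ (MC∞) ∧ (RW₁) (`densityScoreDualBoundFirst_of_gram`,
part V) with (MC∞) PROVED (`skeletonGramLimitInverseMoments_proved`), so the open leaves beneath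
S3 are exactly (Dᵛ), (EBᵃ), (RW₁) `GramControlledWeightMoments`, (SD₁q){0} and (XBᶠ). [folklore] -/
theorem kernelTemperatureLipschitz_of_dilation_gram (hV : KernelTemperatureDilationDuhamel)
    (hA : DilationArrivalBound) (hRW : GramControlledWeightMoments)
    (hq : DensityScoreDualBoundPositionOn {0}) (hF : ExchangeTermBoundFar) :
    KernelTemperatureLipschitz :=
  kernelTemperatureLipschitz_of_dilation_departure hV hA
    (densityScoreDualBoundOn_mono (by simp)
      (densityScoreDualBoundFirst_of_gram skeletonGramLimitInverseMoments_proved hRW)) hq hF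

/-- ★★ **The K_fix junction of record after X-1**:
`K_fix ⟸ A0 ∧ A2 ∧ (Dᵛ) ∧ (EBᵃ) ∧ (RW₁) ∧ (SD₁q){0} ∧ (XBᶠ) ∧ A3p ∧ A4`. [folklore] -/
theorem snapshotKLUpperExpansion_of_atoms₉G (h0 : NessGibbsReweighting)
    (h2 : NessOddLogRatioBound) (hV : KernelTemperatureDilationDuhamel)
    (hA : DilationArrivalBound) (hRW : GramControlledWeightMoments)
    (hq : DensityScoreDualBoundPositionOn {0}) (hF : ExchangeTermBoundFar)
    (h3p : NessFloorMeanValue) (h4 : NessLinearResponseL2) : SnapshotKLUpperExpansion :=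
  snapshotKLUpperExpansion_of_atoms₅K h0 h2
    (kernelTemperatureLipschitz_of_dilation_gram hV hA hRW hq hF) h3p h4

end Summit.AtomisticToContinuum.FouriersLaw.Theorems.ExtensiveSnapshotIrreversibility.EnergyWindow

end
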